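import Literature.Computability.Complexity.PolynomialEntropyApproximation
import Mathlib.Data.Nat.Log
import HarnessLib

/-!
# Route SzkEntropy, crux `PeaTwoMemBPP` (stmt-PneNP-10778): the one-bit leakage problems (definitions)

Objects posited by the line `polarize-to-one-bit-leakage` for the crux `SzkEntropy.PeaTwoMemBPP`
(skeleton `Summits/PneNP/PneNP/Cruxes/PeaTwoMemBPP/Lines/polarize-to-one-bit-leakage.lean`, whose
registered stubs `stub_transfer`, `stub_boost`, `stub_gapQLx` are stated in exactly this vocabulary and
namespace; the polarization vocabulary `polarBit/leak/condEnt/ChainRule/PolarizeRough/PolarizeFine` of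
the other stubs is information theory and lives in `Literature/InformationTheory/Coding/SourcePolarization.lean`):

* `QLInst = Σ N, PolyMapF2 N` and its Boolean `QLInst.encoding` — instances `u :: Φ` of the one-bit
  leakage problems: the HEAD output polynomial is the bit `u`, the TAIL `Φ` the conditioning map;
* `IsQL P` — the syntactic promise: `P` quadratic (`DegLE 2`) with affine-linear head;
* `qleak P = H(P(U_N)) − H(P.tail(U_N)) = H(u(W) | Φ(W))` — the leakage of the head bit given the tail;
* `GapQL` — constant gap: YES `H(u|Φ) ≥ 2/3` (hidden), NO `H(u|Φ) ≤ 1/3` (determined);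
* `xgap N = 2^{-(2^{⌊log₂ N⌋/8}+1)}` and `GapQLx` — the EXTREME-gap version, YES `≥ 1 − xgap N`,
  NO `≤ xgap N`, on instances declaring `N` variables;
* sanity: `xgap_pos`, `xgap_le_quarter`, `GapQLx_disjoint`, `GapQL_disjoint`.

Definitions only (no facts are asserted); the stubs and the composition live in the skeleton and land
as `SzkEntropyPeaTwoMemBPP*.lean`. Sources: Goldreich 2006 §1.2 (promise problems, Cook reductions);
Sahai–Vadhan 2003 (the statistical-distance polarization this replaces at degree 2); the line card
`Cruxes/PeaTwoMemBPP/Lines/polarize-to-one-bit-leakage.md`. [folklore]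
-/

noncomputable section

open Finset
open _root_.Computability
open Literature.InformationTheory.Entropy
open Literature.Computability.Complexity

namespace Summit.PneNP.PneNP.Cruxes.PeaTwoMemBPP.PolarizeToOneBitLeakage

set_option linter.dupNamespace false -- `Summit.PneNP.PneNP.…`: summit = sub-problem name (D-0017 single-conjunct layout)

/-- Instances of the one-bit leakage problems: a number of variables `N` and a sparse map
`P = u :: Φ : F₂^N → F₂^{1+M}` whose HEAD output polynomial is the bit `u` and whose TAIL `Φ` is the
conditioning map (route presentation `PolyMapF2`). [folklore] -/
abbrev QLInst : Type := Σ N : ℕ, PolyMapF2 N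

/-- Boolean encoding of `QLInst`: `N` in binary, then the route's encoding of sparse maps (as for
`PEDInst`). [folklore] -/
def QLInst.encoding : Encoding QLInst Bool :=
  Encoding.sigmaBool PolyMapF2.encoding

/-- Syntactic promise: `P` is quadratic (`DegLE 2`) and its head polynomial `u` is affine-linear
(every monomial of `P.headD []` lists `≤ 1` variable). [folklore] -/
@[folklore] def IsQL {N : ℕ} (P : PolyMapF2 N) : Prop :=
  PolyMapF2.DegLE 2 P ∧ ∀ μ ∈ P.headD [], μ.length ≤ 1

/-- The LEAKAGE of the head bit given the tail: `qleak (u :: Φ) = H((u,Φ)(U_N)) − H(Φ(U_N)) =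
H(u(W) | Φ(W))` for `W` uniform on `F₂^N` (`PolyMapF2.entropy` = Shannon entropy of the output on a
uniform input; `qleak [] = 0`).  In `[0, 1]` by subadditivity. [folklore] -/
def qleak {N : ℕ} (P : PolyMapF2 N) : ℝ :=
  PolyMapF2.entropy P - PolyMapF2.entropy P.tail

/-- `GapQL` (constant gap): YES = HIDDEN (`H(u|Φ) ≥ 2/3`), NO = DETERMINED (`H(u|Φ) ≤ 1/3`), on
instances satisfying `IsQL`. [folklore] -/
def GapQL : PromiseProblem :=
  PromiseProblem.ofEncoding QLInst.encoding
    {I : QLInst | IsQL I.2 ∧ (2 : ℝ) / 3 ≤ qleak I.2}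
    {I : QLInst | IsQL I.2 ∧ qleak I.2 ≤ (1 : ℝ) / 3}

/-- The EXTREME gap as a function of the number of declared variables:
`xgap N = 2^{-(2^{⌊log₂ N⌋/8} + 1)}` (`≈ 2^{-N^{1/8}}`, superpolynomially small; `≤ 1/4` always). [folklore] -/
def xgap (N : ℕ) : ℝ := ((2 : ℝ) ^ (2 ^ (Nat.log 2 N / 8) + 1))⁻¹

/-- `GapQLx` (extreme gap, on BOTH sides): YES = HIDDEN `H(u|Φ) ≥ 1 − xgap N`, NO = DETERMINED
`H(u|Φ) ≤ xgap N`, on `IsQL` instances declaring `N` variables (an instance declaring unused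
variables only makes its own promise more extreme). [folklore] -/
def GapQLx : PromiseProblem :=
  PromiseProblem.ofEncoding QLInst.encoding
    {I : QLInst | IsQL I.2 ∧ 1 - xgap I.1 ≤ qleak I.2}
    {I : QLInst | IsQL I.2 ∧ qleak I.2 ≤ xgap I.1}

/-! ### Sanity of the thresholds -/

/-- `xgap N > 0`. [folklore] -/
theorem xgap_pos (N : ℕ) : 0 < xgap N := by
  unfold xgap; positivity

/-- `xgap N ≤ 1/4`, so the YES and NO sets of `GapQLx` are disjoint. [folklore] -/
theorem xgap_le_quarter (N : ℕ) : xgap N ≤ 1 / 4 := by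
  unfold xgap
  have h4 : (4 : ℝ) ≤ 2 ^ (2 ^ (Nat.log 2 N / 8) + 1) := by
    calc (4 : ℝ) = 2 ^ 2 := by norm_num
      _ ≤ 2 ^ (2 ^ (Nat.log 2 N / 8) + 1) :=
        pow_le_pow_right₀ (by norm_num)
          (by have := Nat.one_le_two_pow (n := Nat.log 2 N / 8); omega)
  have := inv_anti₀ (by norm_num : (0 : ℝ) < 4) h4
  simpa [one_div] using this

/-- `GapQLx` is a disjoint promise problem. [folklore] -/
theorem GapQLx_disjoint : GapQLx.Disjoint := by
  refine PromiseProblem.disjoint_ofEncoding _ (Set.disjoint_left.2 fun I hY hN => ?_)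
  have h1 := hY.2
  have h2 := hN.2
  have h3 := xgap_le_quarter I.1
  linarith

/-- `GapQL` is a disjoint promise problem. [folklore] -/
theorem GapQL_disjoint : GapQL.Disjoint := by
  refine PromiseProblem.disjoint_ofEncoding _ (Set.disjoint_left.2 fun I hY hN => ?_)
  have h1 := hY.2
  have h2 := hN.2
  linarith

end Summit.PneNP.PneNP.Cruxes.PeaTwoMemBPP.PolarizeToOneBitLeakage

end
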